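import Mathlib
import HarnessLib
import Summits.NavierStokesRegularity.NavierStokesRegularity.Theorems.HalfSpaceWindowDoorCirculationCarryingRigidityHorizontalVorticityFloor

/-!
# Route `HalfSpaceWindowDoor`, crux `CirculationCarryingRigidity` (stmt-NavierStokesRegularity-25311) —
# census brick: NO ASYMPTOTIC 2½-DIMENSIONALITY AT SCALE (blow-down, sign-free)

LEAD ns-hsw-p1 g7 (cell pub-ns-dss), `--supports stmt-NavierStokesRegularity-25311 --as helper`; third brick of the blow-down
series (`…PeriodicStratum` p665830: periodic ⇒ 0; `…HorizontalVorticityFloor` p666593: frequently asymptotically vertical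
vorticity ⇒ 0).  Here the symmetry killed in the far past is translation invariance along a direction `e` («2½-dimensionality»),
measured at the self-similar scale:

* `lineInvariant_of_slice` — ONE slice `W(s₀)` of a Type-I ancient mild field invariant under all translations along `e` ⇒ every
  slice is (forward: uniqueness `IsTypeIAncientMild.comp_add_eq_after`; backward: real-analyticity in time); with
  `eq_zero_of_lineInvariant` (p666593): `eq_zero_of_lineInvariant_slice` — such a field is `≡ 0`.
* `eq_zero_of_frequently_planar` — **MAIN.**  A door-class profile (Type-I time rate, continuity, unit-viscosity Oseen–Duhamel
  identity, divergence-free slices) such that for every `ε > 0`, every range `M` and every `T` there is a time `t < T` at which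
  `√(−t)‖v(t, x + θ√(−t)e) − v(t, x)‖ ≤ ε` for all `x` and all `|θ| ≤ M` (the slice is `ε`-close, in scale-invariant size, to its
  translates along `e` over self-similar distances `≤ M√(−t)`) vanishes identically.  Proof: bad points of `exists_uniformly_nonsmall`
  at such times `t_n → −∞` with `ε_n → 0`, `M_n → ∞`; the blow-downs `λ_n v(λ_n² s, x_n + λ_n y)` are `ε_n`-invariant under
  `y ↦ y + θe`, `|θ| ≤ M_n`, on the slice `−1`; an F3-limit has `‖W(−1,0)‖ ≥ ε₀` and an `e`-invariant slice `W(−1)` — contradiction.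
* `farPast_planarityDefect_floor` — contrapositive: a NONTRIVIAL door-class profile has, for every direction `e ≠ 0`, an `ε₁ > 0`, a
  range `M` and an epoch `T < 0` such that on EVERY slice `t < T` some pair `x`, `|θ| ≤ M` has
  `ε₁ < √(−t)‖v(t, x + θ√(−t)e) − v(t, x)‖`.
* `inner_curl_e3_eq_zero_of_frequently_planar` — the census row for the crux (W6 on the stratum, sign-free).

Census meaning.  Dead strata gain {asymptotically 2½-D at scale along a fixed direction, along SOME sequence of far-past times}
⊃ {line-invariant} ∪ {periodic}.  The enemy of W6 keeps a scale-invariant planarity defect `≥ ε₁(e)` within self-similar range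
`M(e)√(−t)` along EVERY direction `e`, at all sufficiently early times.

WHAT THIS IS NOT: not a statement about Navier–Stokes regularity (Clay A); door statements are regularity CRITERIA about
HYPOTHETICAL blow-up profiles.  No item is closed by this file.
-/

noncomputable section

-- the summit and its single sub-problem share the name (CONVENTIONS §1), as in every Theorems file
set_option linter.dupNamespace false

namespace Summit.NavierStokesRegularity.NavierStokesRegularity.Theorems.HalfSpaceWindowDoorCirculationCarryingRigidityAsymptoticPlanarity

open MeasureTheory Set Function Filter Topology
open scoped RealInnerProductSpace InnerProductSpace
open Literature.Analysis Literature.Analysis.FluidPDE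
open Summit.NavierStokesRegularity.NavierStokesRegularity.Theses.HalfSpaceWindowDoor
open Summit.NavierStokesRegularity.NavierStokesRegularity.Theorems.HalfSpaceWindowDoorCirculationCarryingRigidityDefs
open Summit.NavierStokesRegularity.NavierStokesRegularity.Theorems.PoloidalWindowDoorPoloidalWindowRigidityWindow
  (isTypeIAncientMild_of_class)
open Summit.NavierStokesRegularity.NavierStokesRegularity.Theorems.LocalSineTubeDoorProfileAlignedWindowRigidityAncient
  (analyticOnNhd_uncurry bdd_of_hasTypeITimeDecay)
open Summit.NavierStokesRegularity.NavierStokesRegularity.Theorems.PoloidalWindowDoorPoloidalWindowRigidityForwardSmallness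
  (exists_uniformly_nonsmall)
open Summit.NavierStokesRegularity.NavierStokesRegularity.Theorems
  (exists_tendsto_of_isTypeIAncientMild_seq isTypeIAncientMild_zoom zoom_apply)
open Summit.NavierStokesRegularity.NavierStokesRegularity.Theorems.HalfSpaceWindowDoorCirculationCarryingRigidityHorizontalVorticityFloor
  (eq_zero_of_lineInvariant)

variable {C : ℝ}

/-! ### One invariant slice is enough -/

/-- **One `e`-invariant slice ⇒ every slice is `e`-invariant** for Type-I ancient mild fields: forward by uniqueness of bounded
Oseen-mild solutions (`IsTypeIAncientMild.comp_add_eq_after`), backward by real-analyticity in time (identity theorem on `(−∞,0)`). -/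
theorem lineInvariant_of_slice {W : ℝ → EuclideanSpace ℝ (Fin 3) → EuclideanSpace ℝ (Fin 3)} (hW : IsTypeIAncientMild C W)
    {s₀ : ℝ} (hs₀ : s₀ < 0) {e : EuclideanSpace ℝ (Fin 3)} (hA : ∀ (x : EuclideanSpace ℝ (Fin 3)) (θ : ℝ), W s₀ (x + θ • e) = W s₀ x) :
    ∀ t < 0, ∀ (x : EuclideanSpace ℝ (Fin 3)) (θ : ℝ), W t (x + θ • e) = W t x := by
  have hB : ∀ θ : ℝ, ∀ t, s₀ < t → t < 0 → ∀ x : EuclideanSpace ℝ (Fin 3), W t (x + θ • e) = W t x := fun θ =>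
    hW.comp_add_eq_after hs₀ (b := θ • e) fun x => hA x θ
  have han : AnalyticOnNhd ℝ (uncurry W) (Iio (0 : ℝ) ×ˢ univ) :=
    analyticOnNhd_uncurry hW.continuousOn_uncurry (bdd_of_hasTypeITimeDecay hW.hasTypeITimeDecay)
      fun s t hst ht y => hW.mild_eq_heatExtension hst ht y
  intro t ht x θ
  have hline : ∀ z : EuclideanSpace ℝ (Fin 3), AnalyticOnNhd ℝ (fun τ : ℝ => W τ z) (Iio (0 : ℝ)) := fun z =>
    han.comp₂ analyticOnNhd_id analyticOnNhd_const fun _ hτ => mk_mem_prod hτ (mem_univ _)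
  have hdiff : AnalyticOnNhd ℝ (fun τ : ℝ => W τ (x + θ • e) - W τ x) (Iio (0 : ℝ)) :=
    (hline (x + θ • e)).sub (hline x)
  have hev : (fun τ : ℝ => W τ (x + θ • e) - W τ x) =ᶠ[𝓝 (s₀ / 2)] 0 := by
    filter_upwards [Ioo_mem_nhds (show s₀ < s₀ / 2 by linarith) (show s₀ / 2 < 0 by linarith)] with τ hτ
    simp only [Pi.zero_apply, sub_eq_zero]
    exact hB θ τ hτ.1 hτ.2 x
  have h0 : s₀ / 2 ∈ Iio (0 : ℝ) := show s₀ / 2 < 0 by linarith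
  have h := hdiff.eqOn_zero_of_preconnected_of_eventuallyEq_zero isPreconnected_Iio h0 hev ht
  simpa [sub_eq_zero] using h

/-- **A Type-I ancient mild field with ONE slice invariant along a direction `e ≠ 0` is `≡ 0`.** -/
theorem eq_zero_of_lineInvariant_slice {W : ℝ → EuclideanSpace ℝ (Fin 3) → EuclideanSpace ℝ (Fin 3)} (hW : IsTypeIAncientMild C W)
    {s₀ : ℝ} (hs₀ : s₀ < 0) {e : EuclideanSpace ℝ (Fin 3)} (he : e ≠ 0)
    (hA : ∀ (x : EuclideanSpace ℝ (Fin 3)) (θ : ℝ), W s₀ (x + θ • e) = W s₀ x) :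
    ∀ t < 0, ∀ x, W t x = 0 :=
  eq_zero_of_lineInvariant hW he (lineInvariant_of_slice hW hs₀ hA)

/-! ### The blow-down: frequent asymptotic planarity kills -/

/-- **MAIN — frequent asymptotic 2½-dimensionality at scale kills, class form.**  Let `v ∈ IsTypeIAncientMild C` and
`e ∈ ℝ³`, `e ≠ 0`.  If for every `ε > 0`, `M` and `T` there is `t < T` with `√(−t)‖v(t, x + (θ√(−t))e) − v(t, x)‖ ≤ ε` for all `x`
and all `|θ| ≤ M`, then `v ≡ 0`. -/
theorem eq_zero_of_frequently_planar_class {v : ℝ → EuclideanSpace ℝ (Fin 3) → EuclideanSpace ℝ (Fin 3)}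
    (hv : IsTypeIAncientMild C v) {e : EuclideanSpace ℝ (Fin 3)} (he : e ≠ 0)
    (hfreq : ∀ ε > 0, ∀ M T : ℝ, ∃ t < T, ∀ (x : EuclideanSpace ℝ (Fin 3)) (θ : ℝ), |θ| ≤ M →
      Real.sqrt (-t) * ‖v t (x + (θ * Real.sqrt (-t)) • e) - v t x‖ ≤ ε) :
    ∀ t < 0, ∀ x, v t x = 0 := by
  by_contra hne
  push Not at hne
  obtain ⟨t₁, ht₁, x₁, hx₁⟩ := hne
  obtain ⟨ε₀, hε₀, T₀, hT₀, hbad⟩ := exists_uniformly_nonsmall hv.hasTypeITimeDecay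
    (fun s t hst ht x => hv.mild_eq_heatExtension hst ht x) ⟨t₁, ht₁, x₁, hx₁⟩
  -- nearly planar early times with bad points
  have hch : ∀ n : ℕ, ∃ tx : ℝ × EuclideanSpace ℝ (Fin 3), tx.1 < T₀ ∧ tx.1 < -((n : ℝ) + 1) ∧
      (∀ (x : EuclideanSpace ℝ (Fin 3)) (θ : ℝ), |θ| ≤ (n : ℝ) + 1 →
        Real.sqrt (-tx.1) * ‖v tx.1 (x + (θ * Real.sqrt (-tx.1)) • e) - v tx.1 x‖ ≤ 1 / ((n : ℝ) + 1)) ∧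
      ε₀ < Real.sqrt (-tx.1) * ‖v tx.1 tx.2‖ := by
    intro n
    obtain ⟨t, ht, hsmall⟩ := hfreq (1 / ((n : ℝ) + 1)) (by positivity) ((n : ℝ) + 1) (min T₀ (-((n : ℝ) + 1)))
    have htT : t < T₀ := lt_of_lt_of_le ht (min_le_left _ _)
    have htn : t < -((n : ℝ) + 1) := lt_of_lt_of_le ht (min_le_right _ _)
    obtain ⟨x, hx⟩ := hbad t htT
    exact ⟨(t, x), htT, htn, hsmall, hx⟩
  choose tx htT htn hsmall hbig using hch
  set tn : ℕ → ℝ := fun n => (tx n).1 with htn_def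
  set xn : ℕ → EuclideanSpace ℝ (Fin 3) := fun n => (tx n).2 with hxn_def
  have htn_neg : ∀ n, tn n < 0 := fun n => (htT n).trans hT₀
  set lam : ℕ → ℝ := fun n => Real.sqrt (-(tn n)) with hlam
  have hlam0 : ∀ n, 0 < lam n := fun n => Real.sqrt_pos.2 (neg_pos.2 (htn_neg n))
  have hlam2 : ∀ n, lam n ^ 2 = -(tn n) := fun n => Real.sq_sqrt (neg_nonneg.2 (htn_neg n).le)
  set w : ℕ → ℝ → EuclideanSpace ℝ (Fin 3) → EuclideanSpace ℝ (Fin 3) :=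
    fun n => lam n • stPull (lam n ^ 2) (lam n) 0 (xn n) v with hw
  have hwcl : ∀ n, IsTypeIAncientMild C (w n) := fun n => isTypeIAncientMild_zoom hv (hlam0 n) (xn n)
  have hw_apply : ∀ n s y, w n s y = lam n • v (lam n ^ 2 * s) (xn n + lam n • y) := fun n s y =>
    zoom_apply (lam n) (xn n) v s y
  -- nontrivial at `(-1, 0)`
  have hw1 : ∀ n, ε₀ < ‖w n (-1) 0‖ := by
    intro n
    rw [hw_apply, smul_zero, add_zero, mul_neg_one, hlam2, neg_neg, norm_smul, Real.norm_of_nonneg (hlam0 n).le]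
    exact hbig n
  -- nearly invariant along `e` on the slice `-1`
  have hwinv : ∀ (n : ℕ) (y : EuclideanSpace ℝ (Fin 3)) (θ : ℝ), |θ| ≤ (n : ℝ) + 1 →
      ‖w n (-1) (y + θ • e) - w n (-1) y‖ ≤ 1 / ((n : ℝ) + 1) := by
    intro n y θ hθ
    have ht : lam n ^ 2 * (-1) = tn n := by rw [hlam2]; ring
    rw [hw_apply, hw_apply, ht, ← smul_sub, norm_smul, Real.norm_of_nonneg (hlam0 n).le]
    have hx : xn n + lam n • (y + θ • e) = (xn n + lam n • y) + (θ * Real.sqrt (-(tn n))) • e := by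
      rw [smul_add, smul_smul, mul_comm (lam n) θ, add_assoc]
    rw [hx]
    exact hsmall n (xn n + lam n • y) θ hθ
  -- compactness
  obtain ⟨φ, hφ, W, hW, hpt, -, -, -⟩ := exists_tendsto_of_isTypeIAncientMild_seq C hwcl
  have hW1 : ε₀ ≤ ‖W (-1) 0‖ :=
    ge_of_tendsto ((hpt (-1) (by norm_num) 0).norm) (Eventually.of_forall fun j => (hw1 (φ j)).le)
  -- the limit slice is invariant along `e`
  have hWinv : ∀ (y : EuclideanSpace ℝ (Fin 3)) (θ : ℝ), W (-1) (y + θ • e) = W (-1) y := by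
    intro y θ
    have hlimd : Tendsto (fun j => w (φ j) (-1) (y + θ • e) - w (φ j) (-1) y) atTop (𝓝 (W (-1) (y + θ • e) - W (-1) y)) :=
      (hpt (-1) (by norm_num) (y + θ • e)).sub (hpt (-1) (by norm_num) y)
    have hsmallj : ∀ᶠ j in atTop, ‖w (φ j) (-1) (y + θ • e) - w (φ j) (-1) y‖ ≤ 1 / (((φ j : ℕ) : ℝ) + 1) := by
      have hev : ∀ᶠ j : ℕ in atTop, |θ| ≤ ((φ j : ℕ) : ℝ) + 1 := by
        obtain ⟨N, hN⟩ := exists_nat_ge |θ|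
        filter_upwards [eventually_ge_atTop N] with j hj
        have h1 : (N : ℝ) ≤ ((φ j : ℕ) : ℝ) := by exact_mod_cast (hj.trans (hφ.id_le j))
        linarith
      filter_upwards [hev] with j hj
      exact hwinv (φ j) y θ hj
    have hlim0 : Tendsto (fun j : ℕ => 1 / (((φ j : ℕ) : ℝ) + 1)) atTop (𝓝 0) := by
      have h1 : Tendsto (fun j : ℕ => ((φ j : ℕ) : ℝ) + 1) atTop atTop :=
        (tendsto_natCast_atTop_atTop.comp hφ.tendsto_atTop).atTop_add tendsto_const_nhds
      have h2 := h1.inv_tendsto_atTop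
      refine h2.congr fun j => ?_
      simp only [Pi.inv_apply, one_div]
    have hnorm0 : Tendsto (fun j => ‖w (φ j) (-1) (y + θ • e) - w (φ j) (-1) y‖) atTop (𝓝 0) := by
      refine squeeze_zero' (Eventually.of_forall fun j => norm_nonneg _) hsmallj hlim0
    have h := tendsto_nhds_unique hlimd.norm hnorm0
    exact sub_eq_zero.1 (norm_eq_zero.1 h)
  have hW0 := eq_zero_of_lineInvariant_slice hW (by norm_num : (-1 : ℝ) < 0) he hWinv (-1) (by norm_num) 0
  rw [hW0, norm_zero] at hW1
  exact absurd hW1 (not_le.2 hε₀)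

/-- **MAIN — door form.**  A profile of the route's Type-I ancient Oseen-mild class that is, at some time below every `T`,
`ε`-close in scale-invariant size to all its translates along `e ≠ 0` over self-similar distances `≤ M√(−t)`, for every `ε`
and `M`, vanishes identically.  No sign hypothesis. -/
theorem eq_zero_of_frequently_planar {v : ℝ → EuclideanSpace ℝ (Fin 3) → EuclideanSpace ℝ (Fin 3)}
    (hrate : HasTypeITimeDecay C v) (hcont : ContinuousOn (uncurry v) (Iio (0 : ℝ) ×ˢ univ))
    (hmild : ∀ s t : ℝ, s < t → t < 0 → ∀ x,
      v t x = UnboundedOperators.heatExtension (v s) (t - s) x - oseenDuhamel 1 s v v t x)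
    (hdiv : ∀ t < 0, VectorCalculus.IsDivFree (v t)) {e : EuclideanSpace ℝ (Fin 3)} (he : e ≠ 0)
    (hfreq : ∀ ε > 0, ∀ M T : ℝ, ∃ t < T, ∀ (x : EuclideanSpace ℝ (Fin 3)) (θ : ℝ), |θ| ≤ M →
      Real.sqrt (-t) * ‖v t (x + (θ * Real.sqrt (-t)) • e) - v t x‖ ≤ ε) :
    ∀ t < 0, ∀ x, v t x = 0 :=
  eq_zero_of_frequently_planar_class (isTypeIAncientMild_of_class hrate hcont hmild hdiv) he hfreq

/-- **FAR-PAST PLANARITY-DEFECT FLOOR.**  A NONTRIVIAL profile of the route's class has, along every direction `e ≠ 0`, an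
`ε₁ > 0`, a range `M` and an epoch `T < 0` such that every slice `t < T` contains `x` and `|θ| ≤ M` with
`ε₁ < √(−t)‖v(t, x + θ√(−t)e) − v(t, x)‖`. -/
theorem farPast_planarityDefect_floor {v : ℝ → EuclideanSpace ℝ (Fin 3) → EuclideanSpace ℝ (Fin 3)}
    (hrate : HasTypeITimeDecay C v) (hcont : ContinuousOn (uncurry v) (Iio (0 : ℝ) ×ˢ univ))
    (hmild : ∀ s t : ℝ, s < t → t < 0 → ∀ x,
      v t x = UnboundedOperators.heatExtension (v s) (t - s) x - oseenDuhamel 1 s v v t x)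
    (hdiv : ∀ t < 0, VectorCalculus.IsDivFree (v t)) {e : EuclideanSpace ℝ (Fin 3)} (he : e ≠ 0)
    (hne : ∃ t < 0, ∃ x, v t x ≠ 0) :
    ∃ ε₁ : ℝ, 0 < ε₁ ∧ ∃ M T : ℝ, T < 0 ∧ ∀ t < T, ∃ (x : EuclideanSpace ℝ (Fin 3)) (θ : ℝ), |θ| ≤ M ∧
      ε₁ < Real.sqrt (-t) * ‖v t (x + (θ * Real.sqrt (-t)) • e) - v t x‖ := by
  by_contra hcon
  push Not at hcon
  obtain ⟨t₁, ht₁, x₁, hx₁⟩ := hne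
  refine hx₁ (eq_zero_of_frequently_planar hrate hcont hmild hdiv he (fun ε hε M T => ?_) t₁ ht₁ x₁)
  obtain ⟨t, ht, h⟩ := hcon ε hε M (min T (-1)) (lt_of_le_of_lt (min_le_right _ _) (by norm_num))
  exact ⟨t, lt_of_lt_of_le ht (min_le_left _ _), fun x θ hθ => h x θ hθ⟩

/-- **CENSUS ROW (W6 on the stratum «frequently asymptotically 2½-D at scale», sign-free).** -/
theorem inner_curl_e3_eq_zero_of_frequently_planar {v : ℝ → EuclideanSpace ℝ (Fin 3) → EuclideanSpace ℝ (Fin 3)}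
    (hrate : HasTypeITimeDecay C v) (hcont : ContinuousOn (uncurry v) (Iio (0 : ℝ) ×ˢ univ))
    (hmild : ∀ s t : ℝ, s < t → t < 0 → ∀ x,
      v t x = UnboundedOperators.heatExtension (v s) (t - s) x - oseenDuhamel 1 s v v t x)
    (hdiv : ∀ t < 0, VectorCalculus.IsDivFree (v t)) {e : EuclideanSpace ℝ (Fin 3)} (he : e ≠ 0)
    (hfreq : ∀ ε > 0, ∀ M T : ℝ, ∃ t < T, ∀ (x : EuclideanSpace ℝ (Fin 3)) (θ : ℝ), |θ| ≤ M →
      Real.sqrt (-t) * ‖v t (x + (θ * Real.sqrt (-t)) • e) - v t x‖ ≤ ε) :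
    ∀ s < 0, ∀ y, ⟪curl (v s) y, e3⟫ = 0 := by
  intro s hs y
  have heq : v s = fun _ => (0 : EuclideanSpace ℝ (Fin 3)) :=
    funext fun x => eq_zero_of_frequently_planar hrate hcont hmild hdiv he hfreq s hs x
  have hcurl : curl (v s) y = 0 := by
    rw [heq]
    ext i
    fin_cases i <;> simp [curl]
  rw [hcurl, inner_zero_left]

/-- **Bundled form** (`InDoorClass` of `…Defs`): frequent asymptotic planarity along some `e ≠ 0` ⇒ `v ≡ 0`. -/
theorem eq_zero_of_frequently_planar' {v : ℝ → EuclideanSpace ℝ (Fin 3) → EuclideanSpace ℝ (Fin 3)} (hv : InDoorClass C v)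
    {e : EuclideanSpace ℝ (Fin 3)} (he : e ≠ 0)
    (hfreq : ∀ ε > 0, ∀ M T : ℝ, ∃ t < T, ∀ (x : EuclideanSpace ℝ (Fin 3)) (θ : ℝ), |θ| ≤ M →
      Real.sqrt (-t) * ‖v t (x + (θ * Real.sqrt (-t)) • e) - v t x‖ ≤ ε) :
    ∀ t < 0, ∀ x, v t x = 0 :=
  eq_zero_of_frequently_planar hv.1 hv.2.1 hv.2.2.1 hv.2.2.2 he hfreq

end Summit.NavierStokesRegularity.NavierStokesRegularity.Theorems.HalfSpaceWindowDoorCirculationCarryingRigidityAsymptoticPlanarity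

end
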